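import Summits.CriticalPhenomena.PercolationContinuityZ3.Theorems.FK.InfiniteVolumeDLRBadEvent
import Summits.CriticalPhenomena.PercolationContinuityZ3.Theorems.FK.DomainMarkovExtremality
import HarnessLib

/-!
# FK-continuity transplant, FO-06 (construction half): Grimmett's Lemma (4.13) EXACT for the box laws —
# conditionally on the configuration off a region, the law inside is the random-cluster measure of the region
# with the INDUCED boundary condition; kernel form, read inside `Λ_m` off the bad event `D_m(Λ)`

Cell `fk-continuity` (bschramm), row FO-06b-6; support file for the FK-continuity transplant
(`--supports stmt-CriticalPhenomena-4575`); builds on p205010 (kernel theorem, internal audit signed;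
external expert review pending). No named facts, no sorries, standard axioms. General dimension `d`, both `b`.

Grimmett 2006, Lemma (4.13) (p. 71): for a region `Λ` inside the box `Λ_n` and the box measure `φ^b_{Λ_n,p,q}`,
the conditional law of the configuration on `E_Λ` given the configuration `ξ` on `E_{Λ_n} ∖ E_Λ` is the
random-cluster measure of `Λ` with the boundary condition induced by `ξ` (and the wiring of `∂Λ_n` if `b = 1`):
the weight of an inside pattern `ι` is `∝ p^{|ι|}(1-p)^{|E_Λ ∖ ι|} q^{k}` with `k` the number of clusters of the
whole configuration meeting `Λ` — the clusters not meeting `Λ` contribute a factor not depending on `ι`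
(`InfiniteVolumeDLRClusters.clusterCount_add_ncard_image_eq`).  The tree holds the one-sided forms of this lemma
(dominations by the free / wired / forced-wiring measures of the region: `InfiniteVolumeDLRFinite.lean`,
`InfiniteVolumeOutsideSandwich.lean`, `DomainMarkovForcedWiring*.lean`, and the exact law when `ξ` hangs off
the wired set, `Literature/…/RandomClusterExploredWiring.lean`); here is the EXACT law for a general induced
partition, in the vocabulary of the specification kernel `rcCondProb` (`InfiniteVolumeDLRDefs.lean`):

* `rcWeight_union_mul_rcCondWeight_comm` — the ratio identity
  `w(ι₁ ∪ ξ) · w^{ξ}_Λ(ι₂) = w(ι₂ ∪ ξ) · w^{ξ}_Λ(ι₁)` for inside patterns `ι₁, ι₂` over an outside configuration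
  `ξ` OFF the bad event `D_m(Λ)` (so that, by `InfiniteVolumeDLRLocality.lean`, the boundary condition induced
  by `ξ` together with the box wiring is the one read inside `Λ_m`, `Λ ⊆ Λ_m`, `m + 1 ≤ n`);
* `rcWeight_union_eq_rcCondProb_mul_sum` — `w(ι ∪ ξ) = φ^{ξ ∩ Λ_m²}_{Λ,p,q}(ι) · ∑_{ι'} w(ι' ∪ ξ)`;
* the summed form over events (`φ^b_{Λ_n}({ω ∩ E_Λ = η} ∩ H ∖ D_m(Λ))` as a finite sum of kernel values times box
  probabilities of local events) is the companion `InfiniteVolumeDLRBoxExact.lean`.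

## References

* G. Grimmett, *The Random-Cluster Model*, Springer 2006: §4.2 (4.11)–(4.13), Lemma (4.13) p. 71; Lemma (4.39)
  p. 83; proof of Thm. (4.31) eq. (4.45). [Grimmett2006]
-/

noncomputable section

open MeasureTheory Set Filter
open scoped Topology ENNReal

namespace Summit.CriticalPhenomena.PercolationContinuityZ3.Theorems.FK

open Literature.Probability.Percolation Literature.Probability.LatticeModels

variable {d : ℕ}

/-! ### Bookkeeping: inside edges of a region of the box, their lattice images, cardinalities -/

section Bookkeeping

open Finset

variable {n : ℕ} {Λ : Finset (Site d)}

/-- The lattice image of the inside edges of `Λ ⊆ Λ_n` is `E_Λ`. [cite: Grimmett2006, §4.2 (E_Λ)] -/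
theorem image_insideEdges_eq_edgesIn (hΛn : Λ ⊆ box d n) :
    (insideEdges (zdGraph d) hΛn).image (Sym2.map Subtype.val) = edgesIn (zdGraph d) Λ := by
  ext e
  rw [Finset.mem_image]
  constructor
  · rintro ⟨e', he', rfl⟩
    exact (mem_insideEdges_iff_map_val_mem_edgesIn hΛn e').1 he'
  · intro he
    induction e using Sym2.ind with
    | h x y =>
      have hx : x ∈ Λ := (mem_edgesIn_iff.1 he).2 x (Sym2.mem_mk_left x y)
      have hy : y ∈ Λ := (mem_edgesIn_iff.1 he).2 y (Sym2.mem_mk_right x y)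
      refine ⟨s(⟨x, hΛn hx⟩, ⟨y, hΛn hy⟩), ?_, by rw [Sym2.map_mk]⟩
      rw [mem_insideEdges_iff_map_val_mem_edgesIn hΛn, Sym2.map_mk]
      exact he

/-- The lattice image of an inside pattern is an inside pattern of `E_Λ`. [cite: Grimmett2006, §4.2 (E_Λ)] -/
theorem image_subset_edgesIn_of_subset_insideEdges (hΛn : Λ ⊆ box d n) {ι : Finset (Sym2 ↥(box d n))}
    (hι : ι ⊆ insideEdges (zdGraph d) hΛn) : ι.image (Sym2.map Subtype.val) ⊆ edgesIn (zdGraph d) Λ := by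
  rw [← image_insideEdges_eq_edgesIn hΛn]
  exact Finset.image_subset_image hι

/-- Lifting a finite pattern is taking its image. [cite: Grimmett2006, §4.2] -/
theorem liftEdges_coe_eq_coe_image (ι : Finset (Sym2 ↥(box d n))) :
    liftEdges (box d n) (↑ι : BondConfig ↥(box d n)) = ↑(ι.image (Sym2.map Subtype.val)) := by
  rw [Finset.coe_image]; rfl

/-- The lift of a pattern off the inside edges misses `E_Λ`. [cite: Grimmett2006, §4.2] -/
theorem liftEdges_sdiff_edgesIn_of_disjoint (hΛn : Λ ⊆ box d n) {ξ : Finset (Sym2 ↥(box d n))}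
    (hξ : Disjoint ξ (insideEdges (zdGraph d) hΛn)) :
    liftEdges (box d n) (↑ξ : BondConfig ↥(box d n)) \ ↑(edgesIn (zdGraph d) Λ) = liftEdges (box d n) ↑ξ := by
  refine sdiff_eq_left.2 (Set.disjoint_left.2 ?_)
  rintro _ ⟨e', he', rfl⟩ he
  exact Finset.disjoint_left.1 hξ he' ((mem_insideEdges_iff_map_val_mem_edgesIn hΛn e').2 he)

/-- The lift of `ι ∪ ξ`, `ι` inside and `ξ` off the inside edges, in the form `η ∪ (χ ∖ E_Λ)` of the kernel.
[cite: Grimmett2006, §4.2] -/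
theorem liftEdges_coe_union_eq (hΛn : Λ ⊆ box d n) (ι : Finset (Sym2 ↥(box d n))) {ξ : Finset (Sym2 ↥(box d n))}
    (hξ : Disjoint ξ (insideEdges (zdGraph d) hΛn)) :
    liftEdges (box d n) (↑(ι ∪ ξ) : BondConfig ↥(box d n)) =
      ↑(ι.image (Sym2.map Subtype.val)) ∪ (liftEdges (box d n) ↑ξ \ ↑(edgesIn (zdGraph d) Λ)) := by
  rw [liftEdges_sdiff_edgesIn_of_disjoint hΛn hξ, Finset.coe_union, liftEdges, Set.image_union,
    ← liftEdges_coe_eq_coe_image]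
  rfl

/-- The lift of `ι ∪ ξ` read off `E_Λ` is the lift of `ξ`. [cite: Grimmett2006, §4.2] -/
theorem liftEdges_coe_union_sdiff_eq (hΛn : Λ ⊆ box d n) {ι ξ : Finset (Sym2 ↥(box d n))}
    (hι : ι ⊆ insideEdges (zdGraph d) hΛn) (hξ : Disjoint ξ (insideEdges (zdGraph d) hΛn)) :
    liftEdges (box d n) (↑(ι ∪ ξ) : BondConfig ↥(box d n)) \ ↑(edgesIn (zdGraph d) Λ) = liftEdges (box d n) ↑ξ := by
  rw [liftEdges_coe_union_eq hΛn ι hξ, Set.union_sdiff_distrib, sdiff_sdiff, Set.union_self,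
    liftEdges_sdiff_edgesIn_of_disjoint hΛn hξ, Set.sdiff_eq_empty.2, Set.empty_union]
  exact Finset.coe_subset.2 (image_subset_edgesIn_of_subset_insideEdges hΛn hι)

/-- The lift of `ι ∪ ξ` read on `E_Λ` is the image of `ι`. [cite: Grimmett2006, §4.2] -/
theorem liftEdges_coe_union_inter_eq (hΛn : Λ ⊆ box d n) {ι ξ : Finset (Sym2 ↥(box d n))}
    (hι : ι ⊆ insideEdges (zdGraph d) hΛn) (hξ : Disjoint ξ (insideEdges (zdGraph d) hΛn)) :
    liftEdges (box d n) (↑(ι ∪ ξ) : BondConfig ↥(box d n)) ∩ ↑(edgesIn (zdGraph d) Λ) =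
      ↑(ι.image (Sym2.map Subtype.val)) := by
  rw [liftEdges_coe_union_eq hΛn ι hξ, Set.union_inter_distrib_right,
    Set.inter_eq_self_of_subset_left (Finset.coe_subset.2 (image_subset_edgesIn_of_subset_insideEdges hΛn hι))]
  have : (liftEdges (box d n) ↑ξ \ ↑(edgesIn (zdGraph d) Λ)) ∩ ↑(edgesIn (zdGraph d) Λ) = ∅ :=
    Set.sdiff_inter_self
  rw [this, Set.union_empty]

/-- Closed-edge count of `ι ∪ ξ`: inside and outside parts add up. [folklore] -/
theorem card_sdiff_union_eq {α : Type*} [DecidableEq α] {E U ι ξ : Finset α} (hU : U ⊆ E) (hι : ι ⊆ U)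
    (hξ : ξ ⊆ E \ U) : (E \ (ι ∪ ξ)).card = (U \ ι).card + ((E \ U) \ ξ).card := by
  rw [← Finset.card_union_of_disjoint]
  · congr 1
    ext e
    simp only [Finset.mem_sdiff, Finset.mem_union, not_or]
    constructor
    · rintro ⟨heE, heι, heξ⟩
      by_cases heU : e ∈ U
      · exact Or.inl ⟨heU, heι⟩
      · exact Or.inr ⟨⟨heE, heU⟩, heξ⟩
    · rintro (⟨heU, heι⟩ | ⟨⟨heE, heU⟩, heξ⟩)
      · exact ⟨hU heU, heι, fun h => (Finset.mem_sdiff.1 (hξ h)).2 heU⟩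
      · exact ⟨heE, fun h => heU (hι h), heξ⟩
  · exact Finset.disjoint_left.2 fun e h1 h2 => (Finset.mem_sdiff.1 (Finset.mem_sdiff.1 h2).1).2 (Finset.mem_sdiff.1 h1).1

/-- Closed-edge count inside `Λ`, after the transfer to the lattice. [folklore] -/
theorem card_edgesIn_sdiff_image (hΛn : Λ ⊆ box d n) (ι : Finset (Sym2 ↥(box d n))) :
    (edgesIn (zdGraph d) Λ \ ι.image (Sym2.map Subtype.val)).card = (insideEdges (zdGraph d) hΛn \ ι).card := by
  rw [← image_insideEdges_eq_edgesIn hΛn, ← Finset.image_sdiff _ _ (Sym2.map.injective (Subtype.val_injective (p := fun x : Site d => x ∈ box d n))),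
    Finset.card_image_of_injective _ (Sym2.map.injective (Subtype.val_injective (p := fun x : Site d => x ∈ box d n)))]

end Bookkeeping

/-! ### The cluster counts: the box count with its wiring vs. the count of clusters meeting `Λ`, read inside `Λ_m` -/

section Clusters

variable {b : Bool} {n m : ℕ} {Λ : Finset (Site d)}

/-- **Off `D_m(Λ)`, the clusters of the box configuration `ι ∪ ξ` (with the box wiring) meeting `Λ` are counted
inside `Λ_m`**: their number is `k(ι ∪ ((ξ ∩ Λ_m²) ∖ E_Λ), Λ)` read on the lattice (`ι` inside, `ξ` off the inside
edges, `Λ ⊆ Λ_m`, `m + 1 ≤ n`). [cite: Grimmett2006, Lemma (4.39) with Lemma (4.13)] -/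
theorem ncard_image_connectedComponentMk_eq_meetClusterCount (hmn : m + 1 ≤ n) (hΛm : Λ ⊆ box d m)
    (hΛn : Λ ⊆ box d n) (b : Bool) {ξ : Finset (Sym2 ↥(box d n))}
    (hξE : ξ ⊆ (finsetGraph (zdGraph d) (box d n)).edgeFinset) (hξ : Disjoint ξ (insideEdges (zdGraph d) hΛn))
    (hgood : liftEdges (box d n) (↑ξ : BondConfig ↥(box d n)) ∉ regionBadEvent Λ m)
    {ι : Finset (Sym2 ↥(box d n))} (hι : ι ⊆ insideEdges (zdGraph d) hΛn) :
    ((openGraph (↑(ι ∪ ξ) : BondConfig ↥(box d n)) ⊔ wired (boxBC d b n)).connectedComponentMk ''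
        {a : ↥(box d n) | (a : Site d) ∈ Λ}).ncard =
      meetClusterCount (↑(ι.image (Sym2.map Subtype.val)) ∪
        ((liftEdges (box d n) ↑ξ ∩ ↑((box d m).sym2)) \ ↑(edgesIn (zdGraph d) Λ))) ↑Λ := by
  classical
  set G₁ := openGraph (↑(ι ∪ ξ) : BondConfig ↥(box d n)) ⊔ wired (boxBC d b n) with hG₁
  set κ : BondConfig (Site d) := ↑(ι.image (Sym2.map Subtype.val)) ∪
    ((liftEdges (box d n) ↑ξ ∩ ↑((box d m).sym2)) \ ↑(edgesIn (zdGraph d) Λ)) with hκ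
  have hχE : liftEdges (box d n) (↑ξ : BondConfig ↥(box d n)) ⊆ (zdGraph d).edgeSet :=
    liftEdges_subset_edgeSet (by rw [← SimpleGraph.coe_edgeFinset]; exact Finset.coe_subset.2 hξE)
  have hηU : ι.image (Sym2.map Subtype.val) ⊆ edgesIn (zdGraph d) Λ :=
    image_subset_edgesIn_of_subset_insideEdges hΛn hι
  -- reindex both images over `↥Λ`
  have h1 : G₁.connectedComponentMk '' {a : ↥(box d n) | (a : Site d) ∈ Λ} =
      (fun a : ↥Λ => G₁.connectedComponentMk ⟨a, hΛn a.2⟩) '' Set.univ := by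
    ext c
    simp only [Set.mem_image, Set.mem_setOf_eq, Set.mem_univ, true_and]
    constructor
    · rintro ⟨a, ha, rfl⟩
      exact ⟨⟨a, ha⟩, rfl⟩
    · rintro ⟨a, rfl⟩
      exact ⟨⟨a, hΛn a.2⟩, a.2, rfl⟩
  have h2 : (openGraph κ).connectedComponentMk '' (↑Λ : Set (Site d)) =
      (fun a : ↥Λ => (openGraph κ).connectedComponentMk (a : Site d)) '' Set.univ := by
    ext c
    simp only [Set.mem_image, Finset.mem_coe, Set.mem_univ, true_and]
    constructor
    · rintro ⟨a, ha, rfl⟩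
      exact ⟨⟨a, ha⟩, rfl⟩
    · rintro ⟨a, rfl⟩
      exact ⟨a, a.2, rfl⟩
  rw [meetClusterCount_eq, h1, h2]
  refine ncard_image_connectedComponentMk_congr G₁ (openGraph κ) _ _ Set.univ fun a _ a' _ => ?_
  -- box reachability = lattice reachability through the lift and the image wiring = local reachability
  rw [hG₁, reachable_sup_wired_liftEdges_iff, liftEdges_coe_union_eq hΛn ι hξ]
  exact reachable_sup_wired_union_sdiff_iff_inter_sym2 hΛm (forall_image_boxBC_not_mem_box hmn) hχE hgood hηU
    a.2 a'.2

/-- **The `q`-exponents of the ratio identity** (Grimmett's Lemma (4.13): clusters not meeting `Λ` do not see the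
inside pattern): for inside patterns `ι₁, ι₂` over the outside configuration `ξ ∉ D_m(Λ)`,
`k^b(ι₁ ∪ ξ) + k(ι₂ ∪ (ξ ∩ Λ_m²) ∖ E_Λ, Λ) = k^b(ι₂ ∪ ξ) + k(ι₁ ∪ (ξ ∩ Λ_m²) ∖ E_Λ, Λ)`.
[cite: Grimmett2006, Lemma (4.13) (proof) with Lemma (4.39)] -/
theorem clusterCount_union_add_meetClusterCount_eq (hmn : m + 1 ≤ n) (hΛm : Λ ⊆ box d m) (hΛn : Λ ⊆ box d n)
    (b : Bool) {ξ : Finset (Sym2 ↥(box d n))} (hξE : ξ ⊆ (finsetGraph (zdGraph d) (box d n)).edgeFinset)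
    (hξ : Disjoint ξ (insideEdges (zdGraph d) hΛn))
    (hgood : liftEdges (box d n) (↑ξ : BondConfig ↥(box d n)) ∉ regionBadEvent Λ m)
    {ι₁ ι₂ : Finset (Sym2 ↥(box d n))} (hι₁ : ι₁ ⊆ insideEdges (zdGraph d) hΛn)
    (hι₂ : ι₂ ⊆ insideEdges (zdGraph d) hΛn) :
    clusterCount (↑(ι₁ ∪ ξ) : BondConfig ↥(box d n)) (boxBC d b n) +
        meetClusterCount (↑(ι₂.image (Sym2.map Subtype.val)) ∪
          ((liftEdges (box d n) ↑ξ ∩ ↑((box d m).sym2)) \ ↑(edgesIn (zdGraph d) Λ))) ↑Λ =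
      clusterCount (↑(ι₂ ∪ ξ) : BondConfig ↥(box d n)) (boxBC d b n) +
        meetClusterCount (↑(ι₁.image (Sym2.map Subtype.val)) ∪
          ((liftEdges (box d n) ↑ξ ∩ ↑((box d m).sym2)) \ ↑(edgesIn (zdGraph d) Λ))) ↑Λ := by
  have hins : ∀ {ι : Finset (Sym2 ↥(box d n))}, ι ⊆ insideEdges (zdGraph d) hΛn →
      ∀ e ∈ (↑ι : BondConfig ↥(box d n)), ∀ v ∈ e, v ∈ {a : ↥(box d n) | (a : Site d) ∈ Λ} :=
    fun hι e he v hv => by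
      obtain ⟨e', -, rfl⟩ := Finset.mem_map.1 (hι (Finset.mem_coe.1 he))
      obtain ⟨a, -, rfl⟩ := Sym2.mem_map.1 hv
      exact a.2
  have key := clusterCount_add_ncard_image_eq (ζ := (↑ξ : BondConfig ↥(box d n))) (W := boxBC d b n)
    (hins hι₁) (hins hι₂)
  rw [← Finset.coe_union, ← Finset.coe_union,
    ncard_image_connectedComponentMk_eq_meetClusterCount hmn hΛm hΛn b hξE hξ hgood hι₁,
    ncard_image_connectedComponentMk_eq_meetClusterCount hmn hΛm hΛn b hξE hξ hgood hι₂] at key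
  exact key

end Clusters

/-! ### The ratio identity and the conditional weights -/

section Ratio

variable {b : Bool} {p q : ℝ} {n m : ℕ} {Λ : Finset (Site d)}

/-- **Ratio identity** (Grimmett 2006, Lemma (4.13), exact form): for inside patterns `ι₁, ι₂ ⊆ E_Λ` (box copies)
over an outside configuration `ξ ∉ D_m(Λ)` of the box `Λ_n` (`Λ ⊆ Λ_m`, `m + 1 ≤ n`),
`w^b_{Λ_n}(ι₁ ∪ ξ) · w^{ξ∩Λ_m²}_Λ(ι₂) = w^b_{Λ_n}(ι₂ ∪ ξ) · w^{ξ∩Λ_m²}_Λ(ι₁)`: the box weights of two configurations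
agreeing off `E_Λ` are in the ratio of the region's conditional weights. [cite: Grimmett2006, Lemma (4.13)] -/
theorem rcWeight_union_mul_rcCondWeight_comm (hmn : m + 1 ≤ n) (hΛm : Λ ⊆ box d m) (hΛn : Λ ⊆ box d n)
    (b : Bool) (p q : ℝ) {ξ : Finset (Sym2 ↥(box d n))} (hξE : ξ ⊆ (finsetGraph (zdGraph d) (box d n)).edgeFinset)
    (hξ : Disjoint ξ (insideEdges (zdGraph d) hΛn))
    (hgood : liftEdges (box d n) (↑ξ : BondConfig ↥(box d n)) ∉ regionBadEvent Λ m)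
    {ι₁ ι₂ : Finset (Sym2 ↥(box d n))} (hι₁ : ι₁ ⊆ insideEdges (zdGraph d) hΛn)
    (hι₂ : ι₂ ⊆ insideEdges (zdGraph d) hΛn) :
    rcWeight (finsetGraph (zdGraph d) (box d n)) p q (boxBC d b n) (ι₁ ∪ ξ) *
        rcCondWeight p q Λ (liftEdges (box d n) ↑ξ ∩ ↑((box d m).sym2)) (ι₂.image (Sym2.map Subtype.val)) =
      rcWeight (finsetGraph (zdGraph d) (box d n)) p q (boxBC d b n) (ι₂ ∪ ξ) *
        rcCondWeight p q Λ (liftEdges (box d n) ↑ξ ∩ ↑((box d m).sym2)) (ι₁.image (Sym2.map Subtype.val)) := by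
  classical
  set E := (finsetGraph (zdGraph d) (box d n)).edgeFinset with hE
  set U' := insideEdges (zdGraph d) hΛn with hU'
  have hU'E : U' ⊆ E := insideEdges_subset_edgeFinset hΛn
  have hξ' : ξ ⊆ E \ U' := fun e he => Finset.mem_sdiff.2 ⟨hξE he, Finset.disjoint_left.1 hξ he⟩
  have hd₁ : Disjoint ι₁ ξ := Finset.disjoint_left.2 fun e h1 h2 => Finset.disjoint_left.1 hξ h2 (hι₁ h1)
  have hd₂ : Disjoint ι₂ ξ := Finset.disjoint_left.2 fun e h1 h2 => Finset.disjoint_left.1 hξ h2 (hι₂ h1)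
  have hq := clusterCount_union_add_meetClusterCount_eq hmn hΛm hΛn b hξE hξ hgood hι₁ hι₂
  -- abbreviate the exponents
  rw [rcWeight, rcWeight, rcCondWeight_eq, rcCondWeight_eq,
    Finset.card_union_of_disjoint hd₁, Finset.card_union_of_disjoint hd₂,
    card_sdiff_union_eq hU'E hι₁ hξ', card_sdiff_union_eq hU'E hι₂ hξ',
    Finset.card_image_of_injective _ (Sym2.map.injective (Subtype.val_injective (p := fun x : Site d => x ∈ box d n))),
    Finset.card_image_of_injective _ (Sym2.map.injective (Subtype.val_injective (p := fun x : Site d => x ∈ box d n))),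
    card_edgesIn_sdiff_image hΛn, card_edgesIn_sdiff_image hΛn]
  set X := clusterCount (↑(ι₁ ∪ ξ) : BondConfig ↥(box d n)) (boxBC d b n)
  set Y := clusterCount (↑(ι₂ ∪ ξ) : BondConfig ↥(box d n)) (boxBC d b n)
  set K₁ := meetClusterCount (↑(ι₁.image (Sym2.map Subtype.val)) ∪
    ((liftEdges (box d n) ↑ξ ∩ ↑((box d m).sym2)) \ ↑(edgesIn (zdGraph d) Λ))) (↑Λ : Set (Site d))
  set K₂ := meetClusterCount (↑(ι₂.image (Sym2.map Subtype.val)) ∪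
    ((liftEdges (box d n) ↑ξ ∩ ↑((box d m).sym2)) \ ↑(edgesIn (zdGraph d) Λ))) (↑Λ : Set (Site d))
  have hqq : q ^ X * q ^ K₂ = q ^ Y * q ^ K₁ := by rw [← pow_add, ← pow_add, hq]
  calc p ^ (ι₁.card + ξ.card) * (1 - p) ^ ((U' \ ι₁).card + ((E \ U') \ ξ).card) * q ^ X *
        (p ^ ι₂.card * (1 - p) ^ (U' \ ι₂).card * q ^ K₂)
      = p ^ (ι₁.card + ξ.card) * (1 - p) ^ ((U' \ ι₁).card + ((E \ U') \ ξ).card) *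
          (p ^ ι₂.card * (1 - p) ^ (U' \ ι₂).card) * (q ^ X * q ^ K₂) := by ring
    _ = p ^ (ι₁.card + ξ.card) * (1 - p) ^ ((U' \ ι₁).card + ((E \ U') \ ξ).card) *
          (p ^ ι₂.card * (1 - p) ^ (U' \ ι₂).card) * (q ^ Y * q ^ K₁) := by rw [hqq]
    _ = p ^ (ι₂.card + ξ.card) * (1 - p) ^ ((U' \ ι₂).card + ((E \ U') \ ξ).card) * q ^ Y *
        (p ^ ι₁.card * (1 - p) ^ (U' \ ι₁).card * q ^ K₁) := by simp only [pow_add]; ring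

/-- Sums over the inside patterns of `E_Λ`, transferred to the box copies. [folklore] -/
theorem sum_powerset_edgesIn_eq_sum_powerset_insideEdges {M : Type*} [AddCommMonoid M] (hΛn : Λ ⊆ box d n)
    (F : Finset (Sym2 (Site d)) → M) :
    ∑ η₀ ∈ (edgesIn (zdGraph d) Λ).powerset, F η₀ =
      ∑ ι ∈ (insideEdges (zdGraph d) hΛn).powerset, F (ι.image (Sym2.map Subtype.val)) := by
  classical
  rw [← image_insideEdges_eq_edgesIn hΛn, Finset.powerset_image, Finset.sum_image]
  intro ι₁ _ ι₂ _ h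
  exact (Finset.image_injective (Sym2.map.injective (Subtype.val_injective (p := fun x : Site d => x ∈ box d n)))) h

/-- **The conditional weight of an inside pattern, exactly** (Grimmett 2006, Lemma (4.13)): over an outside
configuration `ξ ∉ D_m(Λ)` of the box, `w^b_{Λ_n}(ι ∪ ξ) = φ^{ξ ∩ Λ_m²}_{Λ,p,q}(ι) · ∑_{ι' ⊆ E_Λ} w^b_{Λ_n}(ι' ∪ ξ)`
(`0 ≤ p ≤ 1`, `q > 0`). [cite: Grimmett2006, Lemma (4.13)] -/
theorem rcWeight_union_eq_rcCondProb_mul_sum (hp : p ∈ Set.Icc (0 : ℝ) 1) (hq : 0 < q) (hmn : m + 1 ≤ n)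
    (hΛm : Λ ⊆ box d m) (hΛn : Λ ⊆ box d n) (b : Bool) {ξ : Finset (Sym2 ↥(box d n))}
    (hξE : ξ ⊆ (finsetGraph (zdGraph d) (box d n)).edgeFinset) (hξ : Disjoint ξ (insideEdges (zdGraph d) hΛn))
    (hgood : liftEdges (box d n) (↑ξ : BondConfig ↥(box d n)) ∉ regionBadEvent Λ m)
    {ι : Finset (Sym2 ↥(box d n))} (hι : ι ⊆ insideEdges (zdGraph d) hΛn) :
    rcWeight (finsetGraph (zdGraph d) (box d n)) p q (boxBC d b n) (ι ∪ ξ) =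
      rcCondProb p q Λ (liftEdges (box d n) ↑ξ ∩ ↑((box d m).sym2)) (ι.image (Sym2.map Subtype.val)) *
        ∑ ι' ∈ (insideEdges (zdGraph d) hΛn).powerset,
          rcWeight (finsetGraph (zdGraph d) (box d n)) p q (boxBC d b n) (ι' ∪ ξ) := by
  set ξ' : BondConfig (Site d) := liftEdges (box d n) ↑ξ ∩ ↑((box d m).sym2) with hξ'
  have hZ := rcCondPartition_pos hp hq Λ ξ'
  rw [rcCondPartition_eq, sum_powerset_edgesIn_eq_sum_powerset_insideEdges hΛn] at hZ
  rw [rcCondProb_eq, rcCondPartition_eq, sum_powerset_edgesIn_eq_sum_powerset_insideEdges hΛn,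
    div_mul_eq_mul_div, eq_div_iff hZ.ne', Finset.mul_sum, Finset.mul_sum]
  refine Finset.sum_congr rfl fun ι' hι' => ?_
  rw [rcWeight_union_mul_rcCondWeight_comm hmn hΛm hΛn b p q hξE hξ hgood hι (Finset.mem_powerset.1 hι'), mul_comm]

end Ratio

end Summit.CriticalPhenomena.PercolationContinuityZ3.Theorems.FK

end
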